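import Summits.CriticalPhenomena.PercolationContinuityZ3.Theses.PercTorusSliceFilling
import Summits.CriticalPhenomena.PercolationContinuityZ3.Theorems.PercTorusSliceFillingAssembly
import Summits.CriticalPhenomena.PercolationContinuityZ3.Theorems.PercTorusSliceFillingNoCriticalTorusGiantNecessity
import HarnessLib

/-!
# Crux `TorusNonProliferation` (stmt-CriticalPhenomena-5415) — split certificates
# (crux-strategist s1, 2026-08-17; crux workfile, companion of `STRATEGY-CENSUS.md`)

The typed split `(J) SfFewWithGiant → (W) SfVolumeForcesGiant → (D) SfManyHaveVolume →
TorusNonProliferation` is proved in the Theorems file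
`PercTorusSliceFillingTorusNonProliferationSplit.lean` (`TorusNonProliferation_of_subs`, p173964),
together with `NoCriticalTorusGiant → (J)`.  This workfile records the three children as
definitions (verbatim the hypotheses of that theorem) and certifies the claims the census makes
about them:

* `sfManyHaveVolume_of_torusNonProliferation : TorusNonProliferation → (D)` — (D) is a residue of
  the crux (hence of `ThinClusterRarity` via `ThinClusterTransport`, and of
  `PercAnnulusCrossing.CritAnnulusNonCrossing` via p160739);
* `sfVolumeForcesGiant_of_torusNonProliferation : TorusNonProliferation → (W)` — (W) is weaker
  than the crux (so, with `NoCriticalTorusGiant → (J)` and `TorusNonProliferation → (D)`, the split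
  is an equivalence modulo the route's other crux: `TNP ↔ (W) ∧ (D)` given `NoCriticalTorusGiant`);
* `sfVolumeForcesGiant_of_continuity : PercolationContinuityZ3 → (W)` — (W) is a CONSEQUENCE of
  the sub-problem (no costume / no false-in-d=3 risk of the `m`-uniform kind that killed line
  `birth`: in the continuity world the sf volume is `o(n³)` in probability);
* `closes_via_sfVolumeForcesGiant : SliceFillingUpperBound → (W) → NoCriticalTorusGiant →
  PercolationContinuityZ3` — (W) ALONE fills the crux's slot in the route's deciding theorem:
  the recommended re-glue (`closes` with `TorusNonProliferation` replaced by `(W)`), which removes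
  the `d = 3`-specific, `SpanningClustersAboveSix`-threatened content `(D)` from the route's
  critical path without touching the other two cruxes.
-/

noncomputable section

namespace Summit.CriticalPhenomena.PercolationContinuityZ3.Cruxes.TorusNonProliferation.Split

open MeasureTheory Filter Topology Set
open Literature.Probability.Percolation Literature.Probability.LatticeModels
open Summit.CriticalPhenomena.PercolationContinuityZ3.Theses.PercTorusSliceFilling
open Summit.CriticalPhenomena.PercolationContinuityZ3.Theorems
open Summit.CriticalPhenomena.PercolationContinuityZ3.Theorems.PercTorusSliceFillingAssembly
open Summit.CriticalPhenomena.PercolationContinuityZ3.Theorems.PercTorusSliceFillingNoCriticalTorusGiant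

/-- Child (J): many slice-filling clusters together with an `η n³`-giant are rare. -/
def SfFewWithGiant : Prop :=
  ∀ δ : ℝ, 0 < δ → ∀ η : ℝ, 0 < η → ∃ M : ℕ, ∀ n : ℕ, 3 ≤ n →
    (bondPercolation (torusGraph 3 n) (criticalProbI 3)).real
      {ω | M ≤ Set.ncard {S : Set (TorusSite 3 n) | (∃ x, S = openCluster ω x) ∧
            ∃ i : Fin 3, ∀ t : ZMod n, ∃ y ∈ S, y i = t} ∧
          ∃ x : TorusSite 3 n, η * (n : ℝ) ^ 3 ≤ ((openCluster ω x).ncard : ℝ)} ≤ δ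

/-- Child (W): macroscopic slice-filling volume without a giant is rare (finite-volume uniqueness
on the critical torus). -/
def SfVolumeForcesGiant : Prop :=
  ∀ δ : ℝ, 0 < δ → ∀ ε : ℝ, 0 < ε → ∃ η : ℝ, 0 < η ∧ ∃ N : ℕ, ∀ n : ℕ, N ≤ n →
    (bondPercolation (torusGraph 3 n) (criticalProbI 3)).real
      {ω | ε * (n : ℝ) ^ 3 ≤ (Set.ncard {x : TorusSite 3 n |
            ∃ i : Fin 3, ∀ t : ZMod n, ∃ y ∈ openCluster ω x, y i = t} : ℝ) ∧
          ∀ x : TorusSite 3 n, ((openCluster ω x).ncard : ℝ) < η * (n : ℝ) ^ 3} ≤ δ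

/-- Child (D): many slice-filling clusters with small total slice-filling volume are rare. -/
def SfManyHaveVolume : Prop :=
  ∀ δ : ℝ, 0 < δ → ∃ ε : ℝ, 0 < ε ∧ ∃ M : ℕ, ∀ n : ℕ, 3 ≤ n →
    (bondPercolation (torusGraph 3 n) (criticalProbI 3)).real
      {ω | M ≤ Set.ncard {S : Set (TorusSite 3 n) | (∃ x, S = openCluster ω x) ∧
            ∃ i : Fin 3, ∀ t : ZMod n, ∃ y ∈ S, y i = t} ∧
          (Set.ncard {x : TorusSite 3 n |
            ∃ i : Fin 3, ∀ t : ZMod n, ∃ y ∈ openCluster ω x, y i = t} : ℝ) < ε * (n : ℝ) ^ 3} ≤ δ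

/-- (D) is a residue of the crux: `TorusNonProliferation → SfManyHaveVolume` (drop the volume
conjunct; `ε := 1`). [folklore] -/
theorem sfManyHaveVolume_of_torusNonProliferation (h : TorusNonProliferation) : SfManyHaveVolume := by
  intro δ hδ
  obtain ⟨M, hM⟩ := h δ hδ
  refine ⟨1, one_pos, M, fun n hn => ?_⟩
  exact (measureReal_mono (fun ω hω => hω.1) (measure_ne_top _ _)).trans (hM n hn)

/-- A slice-filling subset of the torus `T_n` has at least `n` elements (it surjects onto a
coordinate circle). [folklore] -/
theorem le_ncard_of_sliceFilling {n : ℕ} [NeZero n] {S : Set (TorusSite 3 n)}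
    (hS : ∃ i : Fin 3, ∀ t : ZMod n, ∃ y ∈ S, y i = t) : n ≤ S.ncard := by
  obtain ⟨i, hi⟩ := hS
  have himg : (fun y : TorusSite 3 n => y i) '' S = Set.univ := by
    ext t
    simp only [Set.mem_image, Set.mem_univ, iff_true]
    obtain ⟨y, hy, rfl⟩ := hi t
    exact ⟨y, hy, rfl⟩
  calc n = (Set.univ : Set (ZMod n)).ncard := by
        rw [Set.ncard_univ, Nat.card_eq_fintype_card, ZMod.card]
    _ = ((fun y : TorusSite 3 n => y i) '' S).ncard := by rw [himg]
    _ ≤ S.ncard := Set.ncard_image_le (Set.toFinite S)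

/-- **(W) is necessary: `PercolationContinuityZ3 → SfVolumeForcesGiant`.**  If `θ(p_c) = 0` then
the slice-filling volume is `o(n³)` in probability: a slice-filling cluster has `≥ n ≥ m + 1`
vertices, so by Markov over the vertices and the finite-range domination
`real_clusterSize_torus_le_zd`, `P(ε n³ ≤ V_sf) ≤ ε⁻¹ P_{ℤ³,p_c}(|C(0)| ≥ m + 1) → 0`
(`tendsto_real_clusterSizeGe`). [folklore] -/
theorem sfVolumeForcesGiant_of_continuity (hS : _root_.PercolationContinuityZ3) :
    SfVolumeForcesGiant := by
  rw [_root_.PercolationContinuityZ3, percolationContinuityZ3_iff] at hS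
  intro δ hδ ε hε
  -- choose `m` with `ε⁻¹ P_{ℤ³}(|C(0)| ≥ m + 1) < δ`
  have hθM : Tendsto (fun M : ℕ => ε⁻¹ * (bondPercolation (zdGraph 3) (criticalProbI 3)).real
      (clusterSizeGe (0 : Site 3) (M + 1))) atTop (𝓝 0) := by
    have h := ((tendsto_real_clusterSizeGe (zdGraph 3) (0 : Site 3) (criticalProbI 3)).comp
      (tendsto_add_atTop_nat 1)).const_mul ε⁻¹
    rwa [hS, mul_zero] at h
  obtain ⟨m, hm⟩ := ((tendsto_order.1 hθM).2 δ hδ).exists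
  refine ⟨1, one_pos, 2 * m + 2, fun n hn => ?_⟩
  haveI : NeZero n := ⟨by omega⟩
  set μT := bondPercolation (torusGraph 3 n) (criticalProbI 3) with hμT
  haveI : IsProbabilityMeasure μT := by rw [hμT]; infer_instance
  set θ' := (bondPercolation (zdGraph 3) (criticalProbI 3)).real
    (clusterSizeGe (0 : Site 3) (m + 1)) with hθ'
  set V : BondConfig (TorusSite 3 n) → ℕ := fun ω => Set.ncard {x : TorusSite 3 n |
    ∃ i : Fin 3, ∀ t : ZMod n, ∃ y ∈ openCluster ω x, y i = t} with hV
  set E : Set (BondConfig (TorusSite 3 n)) := {ω | ε * (n : ℝ) ^ 3 ≤ (V ω : ℝ)} with hE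
  set k := ⌈ε * (n : ℝ) ^ 3⌉₊ with hk
  have hn3 : (0 : ℝ) < (n : ℝ) ^ 3 := by
    have : (0 : ℝ) < n := by exact_mod_cast (show 0 < n by omega)
    positivity
  have hεk : ε * (n : ℝ) ^ 3 ≤ k := Nat.le_ceil _
  have hk0 : 0 < k := Nat.ceil_pos.2 (by positivity)
  -- Markov over vertices: `k P(E) ≤ Σ_x P(m + 1 ≤ |C(x)|)`
  have hmarkov : (k : ℝ) * μT.real E ≤
      ∑ x : TorusSite 3 n, μT.real {ω | m + 1 ≤ (openCluster ω x).ncard} := by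
    refine S1b.natCast_mul_measureReal_le_sum μT
      (fun x => {ω | m + 1 ≤ (openCluster ω x).ncard}) E k
      (fun _ => MeasurableSet.of_discrete) MeasurableSet.of_discrete ?_
    intro ω hω
    have hfin : {x : TorusSite 3 n | ∃ i : Fin 3, ∀ t : ZMod n, ∃ y ∈ openCluster ω x, y i = t}.Finite :=
      Set.toFinite _
    refine ⟨hfin.toFinset, ?_, fun x hx => ?_⟩
    · rw [← Set.ncard_eq_toFinset_card _ hfin]
      exact Nat.ceil_le.2 hω
    · have hx' := (Set.Finite.mem_toFinset _).1 hx
      show m + 1 ≤ (openCluster ω x).ncard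
      exact le_trans (by omega) (le_ncard_of_sliceFilling hx')
  have hsum : ∑ x : TorusSite 3 n, μT.real {ω | m + 1 ≤ (openCluster ω x).ncard} ≤
      (n : ℝ) ^ 3 * θ' := by
    calc ∑ x : TorusSite 3 n, μT.real {ω | m + 1 ≤ (openCluster ω x).ncard}
        ≤ ∑ _x : TorusSite 3 n, θ' := Finset.sum_le_sum fun x _ =>
          real_clusterSize_torus_le_zd (criticalProbI 3) hn x
      _ = (n : ℝ) ^ 3 * θ' := by
          rw [Finset.sum_const, Finset.card_univ, nsmul_eq_mul, Fintype.card_fun, ZMod.card,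
            Fintype.card_fin, Nat.cast_pow]
  have h1 : (k : ℝ) * μT.real E ≤ (k : ℝ) * (ε⁻¹ * θ') := by
    calc (k : ℝ) * μT.real E ≤ (n : ℝ) ^ 3 * θ' := hmarkov.trans hsum
      _ ≤ (ε⁻¹ * k) * θ' := by
          gcongr
          rw [le_inv_mul_iff₀ hε]
          exact hεk
      _ = (k : ℝ) * (ε⁻¹ * θ') := by ring
  have h2 : μT.real E ≤ ε⁻¹ * θ' := le_of_mul_le_mul_left h1 (by exact_mod_cast hk0)
  calc μT.real {ω | ε * (n : ℝ) ^ 3 ≤ (V ω : ℝ) ∧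
        ∀ x : TorusSite 3 n, ((openCluster ω x).ncard : ℝ) < 1 * (n : ℝ) ^ 3}
      ≤ μT.real E := measureReal_mono (fun ω hω => hω.1) (measure_ne_top _ _)
    _ ≤ ε⁻¹ * θ' := h2
    _ ≤ δ := (hm).le

/-- **(W) is weaker than the crux: `TorusNonProliferation → SfVolumeForcesGiant`.**  Off the event
`{M ≤ N_sf}` there are fewer than `M` slice-filling clusters; if moreover every cluster has fewer
than `η n³` vertices with `η := ε / (M + 1)`, the slice-filling volume is
`≤ M η n³ < ε n³` (`card_sliceFilling_vertices_le`). So `{ε n³ ≤ V_sf, no η-giant} ⊆ {M ≤ N_sf}`.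
[folklore] -/
theorem sfVolumeForcesGiant_of_torusNonProliferation (h : TorusNonProliferation) :
    SfVolumeForcesGiant := by
  intro δ hδ ε hε
  obtain ⟨M, hM⟩ := h δ hδ
  have hM1 : (0 : ℝ) < (M : ℝ) + 1 := by positivity
  refine ⟨ε / (M + 1), div_pos hε hM1, 3, fun n hn => ?_⟩
  haveI : NeZero n := ⟨by omega⟩
  set P := bondPercolation (torusGraph 3 n) (criticalProbI 3) with hP
  haveI : IsProbabilityMeasure P := by rw [hP]; infer_instance
  refine le_trans (measureReal_mono (μ := P) (fun ω hω => ?_)) (hM n hn)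
  simp only [Set.mem_setOf_eq] at hω ⊢
  obtain ⟨hV, hG⟩ := hω
  by_contra hlt
  push Not at hlt
  have hfin : {x : TorusSite 3 n | ∃ i : Fin 3, ∀ t : ZMod n, ∃ y ∈ openCluster ω x, y i = t}.Finite :=
    Set.toFinite _
  have hcard := card_sliceFilling_vertices_le n ω M (ε / (M + 1)) hlt hG hfin.toFinset
    (fun x hx => (Set.Finite.mem_toFinset hfin).1 hx)
  have hcardV : (Set.ncard {x : TorusSite 3 n | ∃ i : Fin 3, ∀ t : ZMod n,
      ∃ y ∈ openCluster ω x, y i = t} : ℝ) = (hfin.toFinset.card : ℝ) := by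
    rw [Set.ncard_eq_toFinset_card _ hfin]
  have hn3 : (0 : ℝ) < (n : ℝ) ^ 3 := by positivity
  have hlt' : (M : ℝ) * (ε / (M + 1) * (n : ℝ) ^ 3) < ε * (n : ℝ) ^ 3 := by
    rw [show (M : ℝ) * (ε / (M + 1) * (n : ℝ) ^ 3) = (M : ℝ) / (M + 1) * (ε * (n : ℝ) ^ 3) by ring]
    have hlt1 : (M : ℝ) / (M + 1) < 1 := by
      rw [div_lt_one hM1]
      linarith
    calc (M : ℝ) / (M + 1) * (ε * (n : ℝ) ^ 3) < 1 * (ε * (n : ℝ) ^ 3) :=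
          mul_lt_mul_of_pos_right hlt1 (by positivity)
      _ = ε * (n : ℝ) ^ 3 := one_mul _
  linarith

/-- **Re-glue certificate: (W) alone fills the crux's slot in the deciding theorem.**
`SliceFillingUpperBound → SfVolumeForcesGiant → NoCriticalTorusGiant → PercolationContinuityZ3`.
For `δ > 0`, (W) at `(δ, δ)` gives `η, N`; for `n ≥ max N 3`, averaging `θ ≤ P(C(x) sf)` over the
vertices and counting slice-filling vertices off `Bad := {δ n³ ≤ V_sf}` gives
`θ ≤ δ + P(Bad) ≤ 2δ + P(η-giant)`; let `n → ∞` (`NoCriticalTorusGiant`), then `δ ↓ 0`.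
[folklore] -/
theorem closes_via_sfVolumeForcesGiant (hA : SliceFillingUpperBound) (hW : SfVolumeForcesGiant)
    (hG : NoCriticalTorusGiant) : _root_.PercolationContinuityZ3 := by
  rw [_root_.PercolationContinuityZ3, percolationContinuityZ3_iff]
  set θ := theta (zdGraph 3) (0 : Site 3) (criticalProbI 3)
  have hθ0 : 0 ≤ θ := measureReal_nonneg
  suffices h : ∀ δ : ℝ, 0 < δ → θ ≤ 2 * δ by
    refine le_antisymm ?_ hθ0
    by_contra hlt
    push Not at hlt
    have := h (θ / 4) (by positivity)
    linarith
  intro δ hδ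
  obtain ⟨η, hη, N, hN⟩ := hW δ hδ δ hδ
  -- for each `n ≥ max N 3`: `θ ≤ 2δ + P(η-giant)`
  have key : ∀ n : ℕ, 3 ≤ n → N ≤ n → θ ≤ 2 * δ +
      (bondPercolation (torusGraph 3 n) (criticalProbI 3)).real
        {ω | ∃ x : TorusSite 3 n, η * (n : ℝ) ^ 3 ≤ ((openCluster ω x).ncard : ℝ)} := by
    intro n hn hNn
    haveI : NeZero n := ⟨by omega⟩
    set P := bondPercolation (torusGraph 3 n) (criticalProbI 3) with hP
    haveI : IsProbabilityMeasure P := by rw [hP]; infer_instance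
    set A : TorusSite 3 n → Set (BondConfig (TorusSite 3 n)) := fun x =>
      {ω | ∃ i : Fin 3, ∀ t : ZMod n, ∃ y ∈ openCluster ω x, y i = t} with hAdef
    set V : BondConfig (TorusSite 3 n) → ℕ := fun ω => Set.ncard {x : TorusSite 3 n |
      ∃ i : Fin 3, ∀ t : ZMod n, ∃ y ∈ openCluster ω x, y i = t} with hVdef
    set Gi : Set (BondConfig (TorusSite 3 n)) :=
      {ω | ∃ x : TorusSite 3 n, η * (n : ℝ) ^ 3 ≤ ((openCluster ω x).ncard : ℝ)} with hGidef
    set Bad : Set (BondConfig (TorusSite 3 n)) := {ω | δ * (n : ℝ) ^ 3 ≤ (V ω : ℝ)} with hBad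
    have hcard : Fintype.card (TorusSite 3 n) = n ^ 3 := by
      simp [ZMod.card, Finset.prod_const]
    have hn3 : (0 : ℝ) < (n : ℝ) ^ 3 := by positivity
    -- (1) `n³ θ ≤ Σ_x P(A x)`
    have h1 : (n : ℝ) ^ 3 * θ ≤ ∑ x : TorusSite 3 n, P.real (A x) := by
      have hx : ∀ x ∈ (Finset.univ : Finset (TorusSite 3 n)), θ ≤ P.real (A x) :=
        fun x _ => hA _ n hn x
      calc (n : ℝ) ^ 3 * θ = ∑ _x : TorusSite 3 n, θ := by
            rw [Finset.sum_const, Finset.card_univ, hcard, nsmul_eq_mul]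
            push_cast
            ring
        _ ≤ ∑ x : TorusSite 3 n, P.real (A x) := Finset.sum_le_sum hx
    -- (2) off `Bad`, fewer than `δ n³` slice-filling vertices
    have hcount : ∀ ω, ω ∉ Bad → ∀ F : Finset (TorusSite 3 n), (∀ x ∈ F, ω ∈ A x) →
        (F.card : ℝ) ≤ δ * (n : ℝ) ^ 3 := by
      intro ω hω F hF
      simp only [hBad, Set.mem_setOf_eq, not_le] at hω
      have hFV : F.card ≤ V ω := by
        rw [hVdef, ← Set.ncard_coe_finset F]
        exact Set.ncard_le_ncard (fun x hx => hF x hx) (Set.toFinite _)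
      have : (F.card : ℝ) ≤ (V ω : ℝ) := by exact_mod_cast hFV
      linarith
    -- (3) double counting
    have h3 := sum_measureReal_le P A Bad (δ * (n : ℝ) ^ 3)
      (fun _ => MeasurableSet.of_discrete) MeasurableSet.of_discrete (by positivity) hcount
    rw [hcard] at h3
    push_cast at h3
    -- (4) `P(Bad) ≤ δ + P(Gi)` (child (W))
    have h4 : P.real Bad ≤ δ + P.real Gi := by
      have hsub : Bad ⊆ (Bad ∩ Giᶜ) ∪ Gi := fun ω hω => by
        by_cases hG' : ω ∈ Gi
        · exact Or.inr hG'
        · exact Or.inl ⟨hω, hG'⟩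
      have hW' : P.real (Bad ∩ Giᶜ) ≤ δ := by
        refine le_trans (measureReal_mono (μ := P) (fun ω hω => ?_)) (hN n hNn)
        refine ⟨hω.1, fun x => ?_⟩
        have hx := hω.2
        simp only [hGidef, Set.mem_compl_iff, Set.mem_setOf_eq, not_exists, not_le] at hx
        exact hx x
      calc P.real Bad ≤ P.real ((Bad ∩ Giᶜ) ∪ Gi) := measureReal_mono (μ := P) hsub
        _ ≤ P.real (Bad ∩ Giᶜ) + P.real Gi := measureReal_union_le _ _
        _ ≤ δ + P.real Gi := by linarith
    -- combine
    have h5 : θ ≤ δ + P.real Bad := by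
      have h := h1.trans h3
      have h' : (n : ℝ) ^ 3 * θ ≤ (n : ℝ) ^ 3 * (δ + P.real Bad) := by linarith
      exact le_of_mul_le_mul_left h' hn3
    linarith
  -- let `n → ∞`
  have hlim := hG η hη
  have : θ - 2 * δ ≤ 0 := by
    refine ge_of_tendsto hlim ?_
    filter_upwards [eventually_ge_atTop 3, eventually_ge_atTop N] with n hn hNn
    linarith [key n hn hNn]
  linarith

end Summit.CriticalPhenomena.PercolationContinuityZ3.Cruxes.TorusNonProliferation.Split

end
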